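import Summits.RiemannHypothesis.RiemannHypothesis.Theorems.Splittings.ScrewNodeReduction
import HarnessLib

/-!
# Splittings — SCREW BRIDGE g5, R3 reduced: `U_quad` ⟸ atomic witnesses; IndexBounded ⟹ FOZ ∨ LIM; T2 under OLA

Zero-def carve (seat rh-split-typer-2 g3, R10.8 hand-on of `cards/SPLIT-screw-bridge.md` §10) of §6 and §9 of the scratch of record
`HOME/rh-split-screw-bridge/ScrewBridgeG5.lean` (sha16 c26d31e4e9941ae1, seat rh-split-screw-bridge g5; farm rc 0 / 0 sorry, std
axioms); declaration blocks byte-identical, original namespace and order kept (§6 then §9); imports the §7 carve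
`ScrewNodeReduction.lean`.  Notation spelled inline (no definitions): `U_quad` = the `hU` binder of the tree's
`ScrewBridgeWeakTail.indexTransfer_of_indexLowerBoundQuad`; `LIM` = some level `x* > 0` of off-line distance `|Re ρ − ½|` is
exceeded by only finitely many zeros but every `x* − ε` by infinitely many; `OLA` = for every `η > 0` only finitely many zeros
have `|Re ρ − ½| ≥ η`.  CONTENT (kernel): §6 `ola_not_lim`, `foz_or_lim_of_indexBounded` (with the g5 PAPER theorem
«¬LIM ⟹ U_quad» as hypothesis `hA`: IndexBounded ⟹ FOZ ∨ LIM), `etail_iff_foz_of_thmA_of_ola`; §9 `uquad_of_atomicWitnesses`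
(unconditional, zero-free: witnesses for every `#F` ⟹ `U_quad`, via `negIndex_ge_of_atomicWitness`) and
`etail_iff_foz_of_construction_of_ola` (`hC : ¬LIM → witnesses` and OLA ⟹ ETAIL ⟺ FOZ; FOZ ⟹ ETAIL is the tree's
`ScrewNullComb.etail_of_foz`).  RESIDUAL of T2 after g5: the construction in Lean and the LIM configuration.  [new-combination]

HONEST LABEL (cell rh-split): SPLITTING SEARCH over kernel-typed RH-EQUIVALENCES; a splitting A ∧ B ⟹ RH is CONDITIONAL
bookkeeping unless A and B are both proved; nothing here bears on the truth of RH.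
-/

set_option linter.dupNamespace false

noncomputable section

namespace Summit.RiemannHypothesis.RiemannHypothesis.Theorems.Splittings.ScrewBridgeG5

open Filter Topology Finset Complex
open Literature.NumberTheory.LFunctions
open Summit.RiemannHypothesis.RiemannHypothesis.Theses.RuelleBand
open Summit.RiemannHypothesis.RiemannHypothesis.Theorems.IntegerScrew

/-! ## §6 R3 after g5: the bookkeeping around the paper theorem «¬LIM ⟹ U_quad» (kernel)

Notation (spelled inline, no definitions): `NTZ = ZetaZeros.riemannZetaNontrivialZeros`;
* `U_quad` = the hypothesis `hU` of the tree's `ScrewBridgeWeakTail.indexTransfer_of_indexLowerBoundQuad`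
  («every finite set of quadrant representatives is eventually matched by as many negative eigenvalues»);
* `LIM` («left-accumulating maximal off-line distance») = `∃ x > 0`, only finitely many non-trivial zeros have
  `|Re ρ − ½| > x`, but for every `ε > 0` infinitely many have `|Re ρ − ½| > x − ε`;
* `OLA` («off-line zeros, if infinitely many, approach the line») = `∀ η > 0`, finitely many zeros with `|Re ρ − ½| ≥ η`.
The g5 paper theorem (card §10, R10.4) is `¬LIM → U_quad`; it enters below as the hypothesis `hA`. -/

/-- `OLA` excludes the `LIM` configuration. [folklore] -/
theorem ola_not_lim
    (hola : ∀ η : ℝ, 0 < η →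
      Set.Finite {ρ : ℂ | ρ ∈ ZetaZeros.riemannZetaNontrivialZeros ∧ η ≤ |ρ.re - 1 / 2|}) :
    ¬ (∃ x : ℝ, 0 < x ∧
        Set.Finite {ρ : ℂ | ρ ∈ ZetaZeros.riemannZetaNontrivialZeros ∧ x < |ρ.re - 1 / 2|} ∧
        ∀ ε : ℝ, 0 < ε →
          Set.Infinite {ρ : ℂ | ρ ∈ ZetaZeros.riemannZetaNontrivialZeros ∧ x - ε < |ρ.re - 1 / 2|}) := by
  rintro ⟨x, hx, -, hinf⟩
  refine hinf (x / 2) (by positivity) ((hola (x / 2) (by positivity)).subset ?_)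
  rintro ρ ⟨hρ, hlt⟩
  exact ⟨hρ, by linarith⟩

/-- **R3 after g5 (kernel bookkeeping).** Given the g5 paper theorem `hA : ¬LIM → U_quad`, a bounded negative
index of the screw matrices forces `FOZ ∨ LIM` (tree `indexTransfer_of_indexLowerBoundQuad`). [folklore] -/
theorem foz_or_lim_of_indexBounded
    (hA : ¬ (∃ x : ℝ, 0 < x ∧
        Set.Finite {ρ : ℂ | ρ ∈ ZetaZeros.riemannZetaNontrivialZeros ∧ x < |ρ.re - 1 / 2|} ∧
        ∀ ε : ℝ, 0 < ε →
          Set.Infinite {ρ : ℂ | ρ ∈ ZetaZeros.riemannZetaNontrivialZeros ∧ x - ε < |ρ.re - 1 / 2|}) →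
      ∀ F : Finset ZetaZeros.riemannZetaNontrivialZeros,
        (∀ ρ ∈ F, 1 / 2 < (ρ : ℂ).re ∧ 0 < (ρ : ℂ).im) →
          ∃ N : ℕ, ∀ n : ℕ, N ≤ n →
            F.card ≤ (Finset.univ.filter fun i => (screwMatrix_isHermitian n).eigenvalues i < 0).card)
    (hidx : ∃ K : ℕ, ∀ n : ℕ,
      (Finset.univ.filter fun i => (screwMatrix_isHermitian n).eigenvalues i < 0).card ≤ K) :
    CofiniteCriticalLine ∨
      (∃ x : ℝ, 0 < x ∧
        Set.Finite {ρ : ℂ | ρ ∈ ZetaZeros.riemannZetaNontrivialZeros ∧ x < |ρ.re - 1 / 2|} ∧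
        ∀ ε : ℝ, 0 < ε →
          Set.Infinite {ρ : ℂ | ρ ∈ ZetaZeros.riemannZetaNontrivialZeros ∧ x - ε < |ρ.re - 1 / 2|}) := by
  by_cases hlim : (∃ x : ℝ, 0 < x ∧
      Set.Finite {ρ : ℂ | ρ ∈ ZetaZeros.riemannZetaNontrivialZeros ∧ x < |ρ.re - 1 / 2|} ∧
      ∀ ε : ℝ, 0 < ε →
        Set.Infinite {ρ : ℂ | ρ ∈ ZetaZeros.riemannZetaNontrivialZeros ∧ x - ε < |ρ.re - 1 / 2|})
  · exact Or.inr hlim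
  · exact Or.inl (ScrewBridgeWeakTail.indexTransfer_of_indexLowerBoundQuad (hA hlim) hidx)

/-- **T2 after g5, under OLA (kernel bookkeeping):** given the paper theorem `hA : ¬LIM → U_quad` and `OLA`,
`ETAIL ⟺ FOZ` — the direction `FOZ ⟹ ETAIL` being the tree's unconditional `ScrewNullComb.etail_of_foz`
(typer-2 g3) and `ETAIL ⟹ FOZ` going through `etail_boundedIndex` and `foz_or_lim_of_indexBounded`. [folklore] -/
theorem etail_iff_foz_of_thmA_of_ola
    (hA : ¬ (∃ x : ℝ, 0 < x ∧
        Set.Finite {ρ : ℂ | ρ ∈ ZetaZeros.riemannZetaNontrivialZeros ∧ x < |ρ.re - 1 / 2|} ∧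
        ∀ ε : ℝ, 0 < ε →
          Set.Infinite {ρ : ℂ | ρ ∈ ZetaZeros.riemannZetaNontrivialZeros ∧ x - ε < |ρ.re - 1 / 2|}) →
      ∀ F : Finset ZetaZeros.riemannZetaNontrivialZeros,
        (∀ ρ ∈ F, 1 / 2 < (ρ : ℂ).re ∧ 0 < (ρ : ℂ).im) →
          ∃ N : ℕ, ∀ n : ℕ, N ≤ n →
            F.card ≤ (Finset.univ.filter fun i => (screwMatrix_isHermitian n).eigenvalues i < 0).card)
    (hola : ∀ η : ℝ, 0 < η →
      Set.Finite {ρ : ℂ | ρ ∈ ZetaZeros.riemannZetaNontrivialZeros ∧ η ≤ |ρ.re - 1 / 2|}) :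
    (∃ M₀ : ℕ, ∀ M : ℕ, M₀ ≤ M → 0 < screwPivot M) ↔ CofiniteCriticalLine :=
  ⟨fun het => (foz_or_lim_of_indexBounded hA (ScrewBridgeRawG3.etail_boundedIndex het)).resolve_right
      (ola_not_lim hola),
    fun hfoz => ScrewNullComb.etail_of_foz hfoz⟩

/-! ## §9 Assembly of the g5 reduction of R3 (kernel) -/

open scoped Matrix in
/-- **`U_quad` from atomic witnesses (kernel, unconditional, zero-free).** If for every finite set `F` of
quadrant representatives there are `#F` mean-zero real coefficient vectors on finitely many real positions
with a negative definite kernel Gram form, then `U_quad` holds. [new] -/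
theorem uquad_of_atomicWitnesses
    (hW : ∀ F : Finset ZetaZeros.riemannZetaNontrivialZeros,
      (∀ ρ ∈ F, 1 / 2 < (ρ : ℂ).re ∧ 0 < (ρ : ℂ).im) →
        ∃ r : ℕ, ∃ x : Fin r → ℝ, ∃ α : Fin F.card → Fin r → ℝ,
          (∀ k, ∑ p, α k p = 0) ∧
          ∀ c : Fin F.card → ℝ, c ≠ 0 →
            ∑ p, ∑ p', (∑ k, c k * α k p) * (∑ k, c k * α k p') * zetaScrewKernel (x p) (x p') < 0) :
    ∀ F : Finset ZetaZeros.riemannZetaNontrivialZeros,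
      (∀ ρ ∈ F, 1 / 2 < (ρ : ℂ).re ∧ 0 < (ρ : ℂ).im) →
        ∃ N : ℕ, ∀ n : ℕ, N ≤ n →
          F.card ≤ (Finset.univ.filter fun i => (screwMatrix_isHermitian n).eigenvalues i < 0).card := by
  intro F hF
  obtain ⟨r, x, α, hmean, hneg⟩ := hW F hF
  exact negIndex_ge_of_atomicWitness F.card r x α hmean hneg

/-- **T2 after g5 (kernel bookkeeping, final form).**  Given the g5 PAPER construction
`hC : ¬LIM → atomic witnesses for every finite quadrant set` and `OLA`, `ETAIL ⟺ FOZ`; the kernel parts are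
§7 (node reduction), the tree's index transfer `indexTransfer_of_indexLowerBoundQuad`, `etail_boundedIndex`
and typer-2's `ScrewNullComb.etail_of_foz`. [new] -/
theorem etail_iff_foz_of_construction_of_ola
    (hC : ¬ (∃ x : ℝ, 0 < x ∧
        Set.Finite {ρ : ℂ | ρ ∈ ZetaZeros.riemannZetaNontrivialZeros ∧ x < |ρ.re - 1 / 2|} ∧
        ∀ ε : ℝ, 0 < ε →
          Set.Infinite {ρ : ℂ | ρ ∈ ZetaZeros.riemannZetaNontrivialZeros ∧ x - ε < |ρ.re - 1 / 2|}) →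
      ∀ F : Finset ZetaZeros.riemannZetaNontrivialZeros,
        (∀ ρ ∈ F, 1 / 2 < (ρ : ℂ).re ∧ 0 < (ρ : ℂ).im) →
          ∃ r : ℕ, ∃ x : Fin r → ℝ, ∃ α : Fin F.card → Fin r → ℝ,
            (∀ k, ∑ p, α k p = 0) ∧
            ∀ c : Fin F.card → ℝ, c ≠ 0 →
              ∑ p, ∑ p', (∑ k, c k * α k p) * (∑ k, c k * α k p') * zetaScrewKernel (x p) (x p') < 0)
    (hola : ∀ η : ℝ, 0 < η →
      Set.Finite {ρ : ℂ | ρ ∈ ZetaZeros.riemannZetaNontrivialZeros ∧ η ≤ |ρ.re - 1 / 2|}) :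
    (∃ M₀ : ℕ, ∀ M : ℕ, M₀ ≤ M → 0 < screwPivot M) ↔ CofiniteCriticalLine :=
  etail_iff_foz_of_thmA_of_ola (fun hlim => uquad_of_atomicWitnesses (hC hlim)) hola

end Summit.RiemannHypothesis.RiemannHypothesis.Theorems.Splittings.ScrewBridgeG5

end
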